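import Literature.Probability.RandomPlanarGeometry.HexSAWStripWidthTwoTiltedSpectral
import Literature.Probability.RandomPlanarGeometry.HexSAWStripWidthTwoGaussianExponent
import Literature.Probability.RandomPlanarGeometry.HexSAWBrickWallStripFugacityWidthOneContactCLT
import Literature.Probability.Moments.MGFContinuityTheorem
import HarnessLib

/-!
# ★★★★ THE CENTRAL LIMIT THEOREM for the surface contacts of the critical width-two strip:
# `(#top − θ₂n)/√n ⇒ N(0, σ₂²)`, `θ₂ = (3 − √2)/4`, `σ₂² = (96 − 67√2)/8`, for bridges of every pair of end levels
# (module «WIDTH-TWO CONTACT CLT»; bricks 4–6 of the contact CLT programme, which it completes)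

Topic `Literature/Probability/RandomPlanarGeometry` (continues «WIDTH-TWO TILTED SPECTRAL DECOMPOSITION» — `W2.hatD_two_eq_Lam`, `W2.nilLam_pow_mul_abs_le`,
`W2.rateLam`, `W2.dLam_crit`, `W2.projNumLam_crit`, `W2.pLam_kLam_crit` —, «WIDTH-TWO GAUSSIAN EXPONENT» — `W2.tiltLog`, `W2.hasDerivAt_tiltLog`,
`W2.tiltLog_one`, `W2.tiltLog_ne_zero`, ★ `W2.tendsto_gaussExponent` —, «WIDTH-TWO CONTACT CHERNOFF BOUNDS» — `W2.yOfLam`, `W2.yOfLam_facts`,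
`W2.yOfLam_sub_stripYT_two`, `W2.hatD_two_eq_sum_wD` —, «HAT CONVERGENCE» — `W2.tendsto_hatD_two`, `W2.projTwo_mul_one_add`, `W2.rTwo` —, «CONTACT VARIANCE
RATE» — `W2.limTwo_pos`, `W2.phiTwo` —; USES a-p5's finitely-supported-law plumbing `HexBW.WidthOneYZ.finLaw` / `integral_finLaw` / `finLaw_real_apply` /
`isProbabilityMeasure_finLaw` (`HexSAWBrickWallStripFugacityWidthOneContactCLT.lean`) and CURTISS' CONTINUITY THEOREM
`Literature.Probability.Moments.tendsto_gaussianReal_of_tendsto_mgf` / `tendsto_measureReal_Iic_of_tendsto` (`Moments/MGFContinuityTheorem.lean`), and the lane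
tool `Literature.Analysis.continuous_quadRootBound`).  Lane «pcv-sawmu» (CriticalPhenomena venture), a-p2 g27.  Setting: J. H. Curtiss, Ann. Math. Statist. 13
(1942) Theorem 3 (mgf route to convergence in distribution); W. Feller I (1968) XIII.6 (CLT for the number of renewals); E. Seneta (1973) §1.4; H. Duminil-Copin,
A. Hammond, CMP 324 (2013) §2.2 (the weights).  Nothing below is printed; the statement for the strip is this lineage's.

## What is proved (namespace `…SAW.HV.W2`; `x = x_c`, `y₂ = stripYT 2`, `φ₃ = phiTwo 3 = ½ + x² = (3 − √2)/2`, `σ̂ = (96 − 67√2)/4`)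

§1 Continuity along `λ ↦ (y(λ), λ)`: `continuous_yOfLam`, `continuous_gTwo_comp`, `continuous_uLam_wLam_comp`, `continuous_projNumLam_comp`,
`continuous_dLam_pLam_kLam_comp`, `continuous_rateLam_comp` (via `continuous_quadRootBound`), `continuousAt_nilLam_comp`, `continuousAt_matrix_apply`.
§2 Uniform smallness: `rTwo_lt_half`, ★ `exists_uniform_nbhd` (`|λ − 1| < δ` ⇒ `d > 0`, `R < ½`, `|c₀|, |c₁| ≤ C`), ★★ `uniform_deflation`
(`|(N(y(λ),λ)^{n+2}·P)_{ab}| ≤ 2C(n+2)(½)^n` uniformly for `|λ − 1| < δ`).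
§3 Inverting the tilt: ★ `abs_sub_one_le_yOfLam` (`|λ − 1| ≤ 8|y(λ) − y₂|` on `[½, 3/2]`), ★ `exists_lam_of_small_tilt` (IVT: every `|s| ≤ ε` is `S(λ)`,
`λ ∈ [¾, 5/4]`).
§4 `contactMGFTwo k a b t = Σ exp(t(#top − φ₃k)/√k)·wD(y₂)/D̂(k; y₂)_{ab}`, `wD_two_tilt`, ★ `contactMGFTwo_eq` (`= e^{−tφ₃k/√k}·D̂(k; y₂e^{t/√k})/D̂(k; y₂)`),
★★★ `tendsto_contactMGFTwo_of_tendsto` (along ANY `t_k → t ≠ 0`) and ★★★★ **`tendsto_contactMGFTwo (a b) (t) : M_{k+1}^{ab}(t) → exp(σ₂²·t²)`**, `σ₂² = (96 − 67√2)/8`,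
for EVERY real `t` — assembly: choose `λ_k` with
`S(λ_k) = t/√(k+1)` (§3), `λ_k → 1` within `{1}ᶜ`, `D̂(k+1; y₂e^{s_k}) = λ_k^{k+1}[(Π̃P)_{ab}/d + (N^{k+1}P)_{ab}/λ_k^{k+1}]` (car 14), bracket `→ limTwo_{ab}`
(§1–§2), `D̂(k+1; y₂) → limTwo_{ab}`, and `(k+1)log λ_k − tφ₃√(k+1) = t²·(log λ_k − φ₃S(λ_k))/S(λ_k)² → σ₂²t²` (car 15).
§5 ★★★★ **THE CLT**: `varRateHat_pos`; `contactLawTwo k a b` (the law of `(#top − φ₃k)/√k` as a `finLaw`, Dirac at the finitely many degenerate `k`),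
`isProbabilityMeasure_contactLawTwo`, `integral_exp_mul_contactLawTwo`, `contactLawTwo_real_Iic`; ★★★★ **`tendsto_contactLawTwo (a b)`** —
`law((#top − φ₃k)/√k) ⟶ N(0, σ̂)` WEAKLY in `ProbabilityMeasure ℝ` (Curtiss); ★★★★ **`tendsto_contactCDFTwo (a b) (x)`** —
`P_{k+1}^{ab}(#top ≤ φ₃(k+1) + x√(k+1)) → N(0, σ̂)(−∞, x]` for EVERY real `x`.
§6 ★★★★ **THE PER-STEP FORM**: `contactMGFStepTwo` (MGF of `(#top − θ₂n)/√n`, `n = hatLen k a b`), `contactMGFStepTwo_eq` (change of normalisation,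
`t_k = t√k/√n → t/√2`), ★★★★ `tendsto_contactMGFStepTwo` (`→ exp(σ₂²t²/2)` ∀t), `contactLawStepTwo`, ★★★★ **`tendsto_contactLawStepTwo (a b)`** —
`law((#top − θ₂n)/√n) ⟶ gaussianReal 0 σ₂²` WEAKLY — and ★★★★ **`tendsto_contactCDFStepTwo (a b) (x)`** — `P^{ab}(#top ≤ θ₂n + x√n) → N(0, σ₂²)(−∞, x]` ∀x.

In words: among the critical bridges of the width-two honeycomb strip from level `a` to level `b` with `k` hat steps (`2k + χ_a − χ_b` steps), weighted by
`x_c^{length}·y₂^{#top}`, the number of visits to the top wall is asymptotically Gaussian with mean `φ₃k = 2θ₂k` and variance `σ̂k = 2σ₂²k`: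
mean rate `θ₂ = (3 − √2)/4` and variance rate `σ₂² = (96 − 67√2)/8` PER STEP («CONTACT-DENSITY», «WIDTH-TWO CONTACT VARIANCE RATE»), the same
constants now appearing as the first two derivatives of the logarithm of the Perron root of the tilted transfer matrix.
Label: LANE THEOREM (own result of lane «pcv-sawmu», a-p2 g27, 2026-08-28; not in print).  NOT claimed: a local limit theorem, Berry–Esseen rates,
`T ≥ 3` (infinite-support kernel), β-walks.
-/

noncomputable section

open Finset Filter Topology Matrix MeasureTheory ProbabilityTheory Literature.Probability.LatticeModels Literature.Probability.Percolation Literature.Analysis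
open Literature.Probability.Moments

namespace Literature.Probability.RandomPlanarGeometry.SAW

namespace HV

namespace W2

/-! ## §1 Continuity of the Perron data along the parametrisation `λ ↦ (y(λ), λ)` -/

/-- `y(λ)` is continuous on `ℝ` (its denominator never vanishes). [cite: Seneta1973, §1.4; lane plumbing] -/
theorem continuous_yOfLam : Continuous yOfLam := by
  have h : ∀ lam : ℝ, hexCriticalFugacity ^ 2 * (lam ^ 2 - hexCriticalFugacity ^ 2 * lam + hexCriticalFugacity ^ 4) ≠ 0 := fun lam =>
    mul_ne_zero (by have := hexCriticalFugacity_pos_lt_one.1; positivity) (lamQuad_pos lam).ne'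
  unfold yOfLam
  exact Continuous.div (by fun_prop) (by fun_prop) h

/-- The tilted transfer matrix `λ ↦ G(y(λ))` is continuous. [cite: Seneta1973, §1.4; lane plumbing] -/
theorem continuous_gTwo_comp : Continuous fun lam : ℝ => gTwo (yOfLam lam) := by
  have hy := continuous_yOfLam
  refine continuous_pi fun i => continuous_pi fun j => ?_
  fin_cases i <;> fin_cases j <;> simp [gTwo] <;> fun_prop

/-- `λ ↦ u(y(λ), λ)` and `λ ↦ w(λ)` are continuous. [cite: Seneta1973, §1.4; lane plumbing] -/
theorem continuous_uLam_wLam_comp : (Continuous fun lam : ℝ => uLam (yOfLam lam) lam) ∧ (Continuous fun lam : ℝ => wLam lam) := by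
  have hy := continuous_yOfLam
  refine ⟨continuous_pi fun i => ?_, continuous_pi fun i => ?_⟩
  · fin_cases i <;> simp [uLam] <;> fun_prop
  · fin_cases i <;> simp [wLam] <;> fun_prop

/-- `λ ↦ Π̃(y(λ), λ)` is continuous. [cite: Seneta1973, §1.4; lane plumbing] -/
theorem continuous_projNumLam_comp : Continuous fun lam : ℝ => projNumLam (yOfLam lam) lam := by
  unfold projNumLam
  exact continuous_uLam_wLam_comp.1.matrix_vecMulVec continuous_uLam_wLam_comp.2

/-- `λ ↦ d(y(λ), λ)`, `p`, `κ` are continuous. [cite: Seneta1973, §1.4; lane plumbing] -/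
theorem continuous_dLam_pLam_kLam_comp :
    (Continuous fun lam : ℝ => dLam (yOfLam lam) lam) ∧ (Continuous fun lam : ℝ => pLam (yOfLam lam) lam)
      ∧ (Continuous fun lam : ℝ => kLam (yOfLam lam) lam) := by
  have hy := continuous_yOfLam
  unfold dLam pLam kLam
  exact ⟨by fun_prop, by fun_prop, by fun_prop⟩

/-- `λ ↦ R(y(λ), λ)` (the deflation rate) is continuous. [cite: Stanley2012EC1, §4.1; lane plumbing] -/
theorem continuous_rateLam_comp : Continuous fun lam : ℝ => rateLam (yOfLam lam) lam := by
  obtain ⟨_, hp, hk⟩ := continuous_dLam_pLam_kLam_comp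
  unfold rateLam
  exact Literature.Analysis.continuous_quadRootBound.comp (hp.prodMk hk)

/-- `λ ↦ N(y(λ), λ)` is continuous at `λ = 1` (where `d ≠ 0`). [cite: Seneta1973, §1.4; lane plumbing] -/
theorem continuousAt_nilLam_comp : ContinuousAt (fun lam : ℝ => nilLam (yOfLam lam) lam) 1 := by
  obtain ⟨hd, _, _⟩ := continuous_dLam_pLam_kLam_comp
  have hd1 : dLam (yOfLam 1) 1 ≠ 0 := by rw [yOfLam_one]; exact dLam_crit.2.ne'
  unfold nilLam nilNumLam
  refine ContinuousAt.smul (hd.continuousAt.inv₀ hd1) ?_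
  exact ((hd.continuousAt.smul continuous_gTwo_comp.continuousAt)).sub (continuousAt_id.smul continuous_projNumLam_comp.continuousAt)

/-- Entries and products with a fixed matrix inherit continuity (plumbing). [cite: Seneta1973, §1.4; lane plumbing] -/
theorem continuousAt_matrix_apply {M : ℝ → Matrix (Fin (2 * 2)) (Fin (2 * 2)) ℝ} {l : ℝ} (hM : ContinuousAt M l) (a b : Fin (2 * 2)) :
    ContinuousAt (fun lam => M lam a b) l := by
  have hc : Continuous fun N : Matrix (Fin (2 * 2)) (Fin (2 * 2)) ℝ => N a b := (continuous_apply b).comp (continuous_apply a)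
  exact hc.continuousAt.comp hM

/-! ## §2 Uniform smallness near the critical point -/

/-- `rTwo < 1/2` (indeed `rTwo = √κ₂ ≈ 0.2766`). [cite: Stanley2012EC1, §4.1; lane plumbing] -/
theorem rTwo_lt_half : rTwo < 1 / 2 := by
  obtain ⟨hd, hk0, hk1, hp⟩ := pTwo_kTwo_facts
  obtain ⟨h1, h2⟩ := xc_sq_bounds
  rw [rTwo, Literature.Analysis.quadRootBound]
  refine max_lt ?_ ?_
  · rw [Real.sqrt_eq_zero'.2 hd.le, add_zero]
    have : |pTwo| < 1 / 4 := by rw [pTwo, abs_lt]; constructor <;> linarith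
    linarith
  · have hk4 : kTwo < 1 / 4 := by rw [kTwo]; linarith
    calc Real.sqrt kTwo < Real.sqrt (1 / 4) := Real.sqrt_lt_sqrt hk0.le hk4
      _ = 1 / 2 := by rw [show (1:ℝ) / 4 = (1 / 2) ^ 2 by norm_num, Real.sqrt_sq (by norm_num)]

/-- ★ **A uniform neighbourhood**: there is `δ ∈ (0, 1/4]` such that for `|λ − 1| < δ`: `d(y(λ),λ) > 0`, `R(y(λ),λ) < 1/2`, and the deflation data
`|c₀|, |c₁|` of `N(y(λ),λ)` against `P = 1 + M̂(0)` stay below a constant `C` (all four entries `a, b`).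
[cite: Seneta1973, §1.4; Stanley2012EC1, §4.1; lane «pcv-sawmu» a-p2 g27] -/
theorem exists_uniform_nbhd (a b : Fin (2 * 2)) :
    ∃ δ C : ℝ, 0 < δ ∧ δ ≤ 1 / 4 ∧ 0 ≤ C ∧ ∀ lam : ℝ, |lam - 1| < δ →
      0 < dLam (yOfLam lam) lam ∧ rateLam (yOfLam lam) lam < 1 / 2 ∧
        |(nilLam (yOfLam lam) lam * (1 + hatMZeroTwo)) a b| ≤ C ∧ |((nilLam (yOfLam lam) lam ^ 2 * (1 + hatMZeroTwo) : Matrix (Fin (2 * 2)) (Fin (2 * 2)) ℝ)) a b| ≤ C := by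
  obtain ⟨hdc, _, _⟩ := continuous_dLam_pLam_kLam_comp
  have hd1 : 0 < dLam (yOfLam 1) 1 := by rw [yOfLam_one]; exact dLam_crit.2
  have hr1 : rateLam (yOfLam 1) 1 < 1 / 2 := by rw [yOfLam_one, pLam_kLam_crit.2.2]; exact rTwo_lt_half
  -- eventually-statements at `𝓝 1`
  have e1 : ∀ᶠ lam in 𝓝 (1 : ℝ), 0 < dLam (yOfLam lam) lam := hdc.continuousAt.eventually (eventually_gt_nhds hd1)
  have e2 : ∀ᶠ lam in 𝓝 (1 : ℝ), rateLam (yOfLam lam) lam < 1 / 2 := continuous_rateLam_comp.continuousAt.eventually (eventually_lt_nhds hr1)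
  have hN := continuousAt_nilLam_comp
  have c0 : ContinuousAt (fun lam => (nilLam (yOfLam lam) lam * (1 + hatMZeroTwo)) a b) 1 :=
    continuousAt_matrix_apply (hN.mul continuousAt_const) a b
  have c1 : ContinuousAt (fun lam => ((nilLam (yOfLam lam) lam ^ 2 * (1 + hatMZeroTwo) : Matrix (Fin (2 * 2)) (Fin (2 * 2)) ℝ)) a b) 1 :=
    continuousAt_matrix_apply ((hN.pow 2).mul continuousAt_const) a b
  set v0 : ℝ := (nilLam (yOfLam 1) 1 * (1 + hatMZeroTwo)) a b with hv0
  set v1 : ℝ := ((nilLam (yOfLam 1) 1 ^ 2 * (1 + hatMZeroTwo) : Matrix (Fin (2 * 2)) (Fin (2 * 2)) ℝ)) a b with hv1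
  have e3 : ∀ᶠ lam in 𝓝 (1 : ℝ), |(nilLam (yOfLam lam) lam * (1 + hatMZeroTwo)) a b| ≤ |v0| + |v1| + 1 := by
    have := (Metric.tendsto_nhds.1 c0.tendsto) 1 one_pos
    filter_upwards [this] with lam h
    rw [Real.dist_eq] at h
    have := abs_sub_abs_le_abs_sub ((nilLam (yOfLam lam) lam * (1 + hatMZeroTwo)) a b) v0
    linarith [abs_nonneg v1]
  have e4 : ∀ᶠ lam in 𝓝 (1 : ℝ), |((nilLam (yOfLam lam) lam ^ 2 * (1 + hatMZeroTwo) : Matrix (Fin (2 * 2)) (Fin (2 * 2)) ℝ)) a b| ≤ |v0| + |v1| + 1 := by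
    have := (Metric.tendsto_nhds.1 c1.tendsto) 1 one_pos
    filter_upwards [this] with lam h
    rw [Real.dist_eq] at h
    have := abs_sub_abs_le_abs_sub (((nilLam (yOfLam lam) lam ^ 2 * (1 + hatMZeroTwo) : Matrix (Fin (2 * 2)) (Fin (2 * 2)) ℝ)) a b) v1
    linarith [abs_nonneg v0]
  obtain ⟨δ₀, hδ₀, hall⟩ := Metric.eventually_nhds_iff.1 (((e1.and e2).and e3).and e4)
  refine ⟨min δ₀ (1 / 4), |v0| + |v1| + 1, lt_min hδ₀ (by norm_num), min_le_right _ _, by positivity, fun lam hlam => ?_⟩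
  have h := hall (show dist lam 1 < δ₀ by rw [Real.dist_eq]; exact lt_of_lt_of_le hlam (min_le_left _ _))
  exact ⟨h.1.1.1, h.1.1.2, h.1.2, h.2⟩

/-- ★★ **UNIFORM DEFLATION near criticality**: with `δ, C` of `exists_uniform_nbhd`, for every `λ` with `|λ − 1| < δ` and every `n`,
`|(N(y(λ),λ)^{n+2}·P)_{ab}| ≤ 2C·(n+2)·(1/2)^n`. [cite: Stanley2012EC1, §4.1 Theorem 4.1.1 (iii); lane «pcv-sawmu» a-p2 g27 — own] -/
theorem uniform_deflation (a b : Fin (2 * 2)) :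
    ∃ δ C : ℝ, 0 < δ ∧ δ ≤ 1 / 4 ∧ 0 ≤ C ∧ ∀ lam : ℝ, |lam - 1| < δ →
      (0 < dLam (yOfLam lam) lam) ∧ ∀ n : ℕ,
        |(nilLam (yOfLam lam) lam ^ (n + 2) * (1 + hatMZeroTwo)) a b| ≤ 2 * C * ((n : ℝ) + 2) * (1 / 2) ^ n := by
  obtain ⟨δ, C, hδ, hδ4, hC, h⟩ := exists_uniform_nbhd a b
  refine ⟨δ, C, hδ, hδ4, hC, fun lam hlam => ⟨(h lam hlam).1, fun n => ?_⟩⟩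
  obtain ⟨hd, hR, hc0, hc1⟩ := h lam hlam
  have hx : 0 < hexCriticalFugacity := hexCriticalFugacity_pos_lt_one.1
  have hlam0 : lam ≠ 0 := by
    have : |lam - 1| < 1 / 4 := lt_of_lt_of_le hlam hδ4
    rw [abs_lt] at this; linarith
  have hc := perronCubicTwo_yOfLam lam
  have hb := nilLam_pow_mul_abs_le hc hd.ne' hlam0 (1 + hatMZeroTwo) a b n
  set R := rateLam (yOfLam lam) lam with hRdef
  have hR0 : 0 ≤ R := Literature.Analysis.quadRootBound_nonneg _ _
  have hRn : R ^ n ≤ (1 / 2) ^ n := pow_le_pow_left₀ hR0 hR.le n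
  have hRn1 : R ^ (n + 1) ≤ (1 / 2) ^ n := by
    calc R ^ (n + 1) ≤ R ^ n := pow_le_pow_of_le_one hR0 (by linarith) (by omega)
      _ ≤ (1 / 2) ^ n := hRn
  have h2n : (0 : ℝ) ≤ (1 / 2) ^ n := by positivity
  calc |(nilLam (yOfLam lam) lam ^ (n + 2) * (1 + hatMZeroTwo)) a b|
      ≤ R ^ (n + 1) * |(nilLam (yOfLam lam) lam * (1 + hatMZeroTwo)) a b|
        + ((n : ℝ) + 1) * R ^ n * (|((nilLam (yOfLam lam) lam ^ 2 * (1 + hatMZeroTwo) : Matrix (Fin (2 * 2)) (Fin (2 * 2)) ℝ)) a b| + R * |(nilLam (yOfLam lam) lam * (1 + hatMZeroTwo)) a b|) := hb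
    _ ≤ (1 / 2) ^ n * C + ((n : ℝ) + 1) * (1 / 2) ^ n * (C + 1 / 2 * C) := by
        have hn0 : (0 : ℝ) ≤ (n : ℝ) + 1 := by positivity
        have t1 : R ^ (n + 1) * |(nilLam (yOfLam lam) lam * (1 + hatMZeroTwo)) a b| ≤ (1 / 2) ^ n * C :=
          mul_le_mul hRn1 hc0 (abs_nonneg _) h2n
        have t2 : |((nilLam (yOfLam lam) lam ^ 2 * (1 + hatMZeroTwo) : Matrix (Fin (2 * 2)) (Fin (2 * 2)) ℝ)) a b| + R * |(nilLam (yOfLam lam) lam * (1 + hatMZeroTwo)) a b|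
            ≤ C + 1 / 2 * C := add_le_add hc1 (mul_le_mul hR.le hc0 (abs_nonneg _) (by norm_num))
        have t3 : ((n : ℝ) + 1) * R ^ n * (|((nilLam (yOfLam lam) lam ^ 2 * (1 + hatMZeroTwo) : Matrix (Fin (2 * 2)) (Fin (2 * 2)) ℝ)) a b|
            + R * |(nilLam (yOfLam lam) lam * (1 + hatMZeroTwo)) a b|) ≤ ((n : ℝ) + 1) * (1 / 2) ^ n * (C + 1 / 2 * C) :=
          mul_le_mul (mul_le_mul_of_nonneg_left hRn hn0) t2 (by positivity) (by positivity)
        linarith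
    _ ≤ 2 * C * ((n : ℝ) + 2) * (1 / 2) ^ n := by
        have hn0 : (0 : ℝ) ≤ (n : ℝ) := Nat.cast_nonneg n
        nlinarith [mul_nonneg hC h2n, mul_nonneg (mul_nonneg hC h2n) hn0]

/-! ## §3 Inverting the tilt: `λ` with `S(λ) = s` for small `s`, and `|λ − 1| ≤ 8·|y(λ) − y₂|` -/

/-- ★ On `[½, 3/2]`: `|λ − 1| ≤ 8·|y(λ) − y₂|` (from `y(λ) − y₂ = (λ − 1)Q(λ)/Den(λ)` with `Den ≤ 1`, `Q ≥ ⅛` there).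
[cite: Seneta1973, §1.4; lane «pcv-sawmu» a-p2 g27] -/
theorem abs_sub_one_le_yOfLam {lam : ℝ} (h1 : 1 / 2 ≤ lam) (h2 : lam ≤ 3 / 2) : |lam - 1| ≤ 8 * |yOfLam lam - stripYT 2| := by
  obtain ⟨hb1, hb2⟩ := xc_sq_bounds
  have hx : 0 < hexCriticalFugacity := hexCriticalFugacity_pos_lt_one.1
  set s := hexCriticalFugacity ^ 2 with hs
  have e4 : hexCriticalFugacity ^ 4 = s ^ 2 := by rw [hs]; ring
  -- Q and Den
  set Q : ℝ := (1 - s + s ^ 2) * lam ^ 2 - s * (1 - s) ^ 2 * lam + s ^ 2 * (1 - s) with hQ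
  set Den : ℝ := s * (lam ^ 2 - s * lam + s ^ 2) * (1 - s + s ^ 2) with hDen
  have hQpos : 1 / 8 ≤ Q := by rw [hQ]; nlinarith [sq_nonneg (lam - 1 / 2), mul_nonneg (by linarith : (0:ℝ) ≤ lam - 1 / 2) (by nlinarith : (0:ℝ) ≤ 1 - s + s ^ 2)]
  have hDen0 : 0 < Den := by
    rw [hDen]; exact mul_pos (mul_pos (by positivity) (by nlinarith [sq_nonneg (lam - s / 2)])) (by nlinarith)
  have hq0 : 0 < lam ^ 2 - s * lam + s ^ 2 := by nlinarith [sq_nonneg (lam - s / 2)]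
  have hq2 : lam ^ 2 - s * lam + s ^ 2 ≤ 5 / 2 := by nlinarith
  have hA0 : 0 < 1 - s + s ^ 2 := by nlinarith
  have hA1 : 1 - s + s ^ 2 ≤ 1 := by nlinarith
  have hs3 : s ≤ 3 / 10 := by norm_num at hb2; linarith
  have hDen1 : Den ≤ 1 := by
    rw [hDen]
    calc s * (lam ^ 2 - s * lam + s ^ 2) * (1 - s + s ^ 2) ≤ 3 / 10 * (5 / 2) * 1 :=
          mul_le_mul (mul_le_mul hs3 hq2 hq0.le (by norm_num)) hA1 hA0.le (by positivity)
      _ ≤ 1 := by norm_num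
  have key : yOfLam lam - stripYT 2 = (lam - 1) * Q / Den := by
    rw [yOfLam_sub_stripYT_two lam, hQ, hDen, e4]
  have e : lam - 1 = (yOfLam lam - stripYT 2) * Den / Q := by
    rw [key]; field_simp
  rw [e, abs_div, abs_mul, abs_of_pos hDen0, abs_of_pos (lt_of_lt_of_le (by norm_num) hQpos)]
  rw [div_le_iff₀ (lt_of_lt_of_le (by norm_num) hQpos)]
  have ha : 0 ≤ |yOfLam lam - stripYT 2| := abs_nonneg _
  nlinarith [mul_le_mul_of_nonneg_left hDen1 ha, mul_le_mul_of_nonneg_left hQpos ha]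

/-- ★ **Small tilts are attained**: there is `ε > 0` such that every `s` with `|s| ≤ ε` is `S(λ)` for some `λ ∈ [¾, 5/4]` (intermediate value theorem for
the continuous `S` on `[¾, 5/4]`, which is negative at `¾` and positive at `5/4`). [cite: Seneta1973, §1.4; lane «pcv-sawmu» a-p2 g27] -/
theorem exists_lam_of_small_tilt :
    ∃ ε : ℝ, 0 < ε ∧ ∀ s : ℝ, |s| ≤ ε → ∃ lam : ℝ, 3 / 4 ≤ lam ∧ lam ≤ 5 / 4 ∧ tiltLog lam = s := by
  obtain ⟨hb1, hb2⟩ := xc_sq_bounds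
  have hx34 : hexCriticalFugacity ^ 2 < 3 / 4 := by linarith
  have hcont : ContinuousOn tiltLog (Set.Icc (3 / 4 : ℝ) (5 / 4)) := fun lam hlam =>
    (hasDerivAt_tiltLog (lt_of_lt_of_le hx34 hlam.1)).continuousAt.continuousWithinAt
  have hneg : tiltLog (3 / 4) < 0 := by
    have hne := tiltLog_ne_zero (lam := 3 / 4) hx34 (by norm_num)
    have hy2 : 0 < stripYT 2 := stripYT_pos (by norm_num)
    obtain ⟨hy, hylt⟩ := yOfLam_facts.2 (3 / 4) hx34 (by norm_num)
    have : tiltLog (3 / 4) ≤ 0 := by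
      rw [tiltLog, sub_nonpos]; exact Real.log_le_log hy hylt.le
    exact lt_of_le_of_ne this hne
  have hpos : 0 < tiltLog (5 / 4) := by
    have hne := tiltLog_ne_zero (lam := 5 / 4) (by linarith) (by norm_num)
    have hy2 : 0 < stripYT 2 := stripYT_pos (by norm_num)
    have hylt := yOfLam_facts.1 (5 / 4) (by norm_num)
    have : 0 ≤ tiltLog (5 / 4) := by
      rw [tiltLog, sub_nonneg]; exact Real.log_le_log hy2 hylt.le
    exact lt_of_le_of_ne this hne.symm
  refine ⟨min (-tiltLog (3 / 4)) (tiltLog (5 / 4)), lt_min (by linarith) hpos, fun s hs => ?_⟩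
  have hs' := abs_le.1 hs
  have hmem : s ∈ Set.Icc (tiltLog (3 / 4)) (tiltLog (5 / 4)) :=
    ⟨by linarith [min_le_left (-tiltLog (3 / 4)) (tiltLog (5 / 4))], by linarith [min_le_right (-tiltLog (3 / 4)) (tiltLog (5 / 4))]⟩
  obtain ⟨lam, hlam, hval⟩ := intermediate_value_Icc (by norm_num) hcont hmem
  exact ⟨lam, hlam.1, hlam.2, hval⟩

/-! ## §4 The moment generating function of the standardised contact count converges to the Gaussian -/

/-- The moment generating function of the centred, `√k`-scaled number of surface contacts of a critical width-two bridge `a → b` of hat index `k`: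
`M_k^{ab}(t) = Σ_bridges exp(t·(#top − φ₃k)/√k)·wD(y₂) / D̂(k; y₂)_{ab}`. [cite: Feller1968, XIII.6; DuminilCopinHammond2013, §2.2; lane «pcv-sawmu» a-p2 g27] -/
def contactMGFTwo (k : ℕ) (a b : Fin (2 * 2)) (t : ℝ) : ℝ :=
  (∑ l ∈ LUset 2 (2 * k + 1) (hatLen k a b) (a : ℕ) (b : ℕ),
      Real.exp (t * ((topCnt 2 l.tail : ℝ) - phiTwo 3 * (k : ℝ)) / Real.sqrt (k : ℝ)) * wD 2 (stripYT 2) l) / hatD 2 (stripYT 2) k a b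

/-- Exponential tilting: `wD(y₂·eˢ) = e^{s·#top}·wD(y₂)`. [cite: Feller1968, XIII.6; lane plumbing] -/
theorem wD_two_tilt (s : ℝ) (l : List HV) : wD 2 (stripYT 2 * Real.exp s) l = Real.exp (s * (topCnt 2 l.tail : ℝ)) * wD 2 (stripYT 2) l := by
  rw [wD, wD, mul_pow, ← Real.exp_nat_mul]
  ring_nf

/-- ★ **The MGF is a ratio of tilted hat bridge sums**: `M_k^{ab}(t) = exp(−tφ₃k/√k) · D̂(k; y₂e^{t/√k})_{ab} / D̂(k; y₂)_{ab}`.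
[cite: Feller1968, XIII.6; lane «pcv-sawmu» a-p2 g27] -/
theorem contactMGFTwo_eq (k : ℕ) (a b : Fin (2 * 2)) (t : ℝ) :
    contactMGFTwo k a b t = Real.exp (-(t * (phiTwo 3 * (k : ℝ)) / Real.sqrt (k : ℝ)))
      * hatD 2 (stripYT 2 * Real.exp (t / Real.sqrt (k : ℝ))) k a b / hatD 2 (stripYT 2) k a b := by
  rw [contactMGFTwo, hatD_two_eq_sum_wD (stripYT 2 * Real.exp (t / Real.sqrt (k : ℝ))), Finset.mul_sum]
  congr 1
  refine Finset.sum_congr rfl fun l _ => ?_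
  rw [wD_two_tilt, ← mul_assoc, ← Real.exp_add]
  congr 2
  ring

/-- ★★★ **Gaussian limit of the MGF along any convergent sequence of arguments** `t_k → t ≠ 0`: `M_{k+1}^{ab}(t_k) → exp(σ₂²·t²)` — the form needed
for re-normalisations of the statistic (per-step CLT below); the fixed-`t` statement is `tendsto_contactMGFTwo`.
[cite: Feller1968, XIII.6; Seneta1973, §1.4; lane «pcv-sawmu» a-p2 g27 — own result] -/
theorem tendsto_contactMGFTwo_of_tendsto (a b : Fin (2 * 2)) {tseq : ℕ → ℝ} {t : ℝ} (ht : Tendsto tseq atTop (𝓝 t)) (ht0 : t ≠ 0) :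
    Tendsto (fun k : ℕ => contactMGFTwo (k + 1) a b (tseq k)) atTop (𝓝 (Real.exp ((96 - 67 * Real.sqrt 2) / 8 * t ^ 2))) := by
  have hy2 : 0 < stripYT 2 := stripYT_pos (by norm_num)
  have hA : 0 < limTwo a b := limTwo_pos a b
  -- D̂(k+1; y₂) → A
  have hD : Tendsto (fun k : ℕ => hatD 2 (stripYT 2) (k + 1) a b) atTop (𝓝 (limTwo a b)) :=
    (tendsto_hatD_two a b).comp (tendsto_add_atTop_nat 1)
  -- the tilts `s_k = t/√(k+1) → 0`, all nonzero
  set s : ℕ → ℝ := fun k => tseq k / Real.sqrt ((k : ℝ) + 1) with hs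
  have hsq : ∀ k : ℕ, 0 < Real.sqrt ((k : ℝ) + 1) := fun k => Real.sqrt_pos.2 (by positivity)
  have hev_t0 : ∀ᶠ k : ℕ in atTop, tseq k ≠ 0 := ht.eventually_ne ht0
  have hs0 : ∀ k, tseq k ≠ 0 → s k ≠ 0 := fun k hk => div_ne_zero hk (hsq k).ne'
  have hs_lim : Tendsto s atTop (𝓝 0) := by
    have h1 : Tendsto (fun k : ℕ => Real.sqrt ((k : ℝ) + 1)) atTop atTop :=
      Real.tendsto_sqrt_atTop.comp (tendsto_natCast_atTop_atTop.atTop_add tendsto_const_nhds)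
    have := ht.mul h1.inv_tendsto_atTop
    rw [mul_zero] at this
    simpa [hs, div_eq_mul_inv] using this
  -- the Perron roots `λ_k` with `S(λ_k) = s_k`
  obtain ⟨ε, hε, hinv⟩ := exists_lam_of_small_tilt
  have hev_s : ∀ᶠ k : ℕ in atTop, |s k| ≤ ε := by
    have := (Metric.tendsto_nhds.1 hs_lim) ε hε
    filter_upwards [this] with k hk
    rw [Real.dist_eq, sub_zero] at hk
    exact hk.le
  classical
  set lamSeq : ℕ → ℝ := fun k => if h : |s k| ≤ ε then Classical.choose (hinv (s k) h) else 1 with hlamSeq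
  have hlam_spec : ∀ k, |s k| ≤ ε → 3 / 4 ≤ lamSeq k ∧ lamSeq k ≤ 5 / 4 ∧ tiltLog (lamSeq k) = s k := fun k hk => by
    have h := Classical.choose_spec (hinv (s k) hk)
    simp only [hlamSeq, dif_pos hk]
    exact h
  obtain ⟨hb1, hb2⟩ := xc_sq_bounds
  have hx34 : hexCriticalFugacity ^ 2 < 3 / 4 := by linarith
  -- `y(λ_k) = y₂·e^{s_k}` and `λ_k → 1`, `λ_k ≠ 1`
  have hy_eq : ∀ k, |s k| ≤ ε → yOfLam (lamSeq k) = stripYT 2 * Real.exp (s k) := fun k hk => by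
    obtain ⟨h34, h54, hS⟩ := hlam_spec k hk
    have hy : 0 < yOfLam (lamSeq k) := yOfLam_pos (lt_of_lt_of_le hx34 h34)
    rw [tiltLog, sub_eq_iff_eq_add] at hS
    calc yOfLam (lamSeq k) = Real.exp (Real.log (yOfLam (lamSeq k))) := (Real.exp_log hy).symm
      _ = stripYT 2 * Real.exp (s k) := by rw [hS, Real.exp_add, Real.exp_log hy2, mul_comm]
  have hlam_ne : ∀ k, |s k| ≤ ε → tseq k ≠ 0 → lamSeq k ≠ 1 := fun k hk hk0 h1 => by
    obtain ⟨_, _, hS⟩ := hlam_spec k hk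
    rw [h1, tiltLog_one.1] at hS
    exact hs0 k hk0 hS.symm
  have hlam_lim : Tendsto lamSeq atTop (𝓝 1) := by
    rw [Metric.tendsto_nhds]
    intro η hη
    -- |λ_k − 1| ≤ 8·y₂·|e^{s_k} − 1| → 0
    have hexp : Tendsto (fun k => 8 * (stripYT 2 * |Real.exp (s k) - 1|)) atTop (𝓝 (8 * (stripYT 2 * |Real.exp 0 - 1|))) :=
      ((((Real.continuous_exp.tendsto 0).comp hs_lim).sub_const 1).abs.const_mul (stripYT 2)).const_mul 8
    rw [Real.exp_zero, sub_self, abs_zero, mul_zero, mul_zero] at hexp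
    filter_upwards [hev_s, (Metric.tendsto_nhds.1 hexp) η hη] with k hk hk2
    obtain ⟨h34, h54, _⟩ := hlam_spec k hk
    rw [Real.dist_eq]
    rw [Real.dist_eq, sub_zero, abs_of_nonneg (by positivity)] at hk2
    have hb := abs_sub_one_le_yOfLam (lam := lamSeq k) (by linarith) (by linarith)
    rw [hy_eq k hk, show stripYT 2 * Real.exp (s k) - stripYT 2 = stripYT 2 * (Real.exp (s k) - 1) by ring, abs_mul, abs_of_pos hy2] at hb
    linarith
  have hlam_lim' : Tendsto lamSeq atTop (𝓝[≠] 1) :=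
    tendsto_nhdsWithin_iff.2 ⟨hlam_lim, by filter_upwards [hev_s, hev_t0] with k hk hk0; exact hlam_ne k hk hk0⟩
  -- the exponent `t_k²·F(λ_k) → σ₂²t²`
  have hF := (ht.pow 2).mul (tendsto_gaussExponent.comp hlam_lim')
  -- uniform deflation and the prefactor
  obtain ⟨δ, C, hδ, hδ4, hC, hdefl⟩ := uniform_deflation a b
  have hev_δ : ∀ᶠ k : ℕ in atTop, |lamSeq k - 1| < δ := by
    have := (Metric.tendsto_nhds.1 hlam_lim) δ hδ
    filter_upwards [this] with k hk; rwa [Real.dist_eq] at hk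
  -- prefactor `(Π̃P)_{ab}/d → A`
  have hpre : Tendsto (fun k => (projNumLam (yOfLam (lamSeq k)) (lamSeq k) * (1 + hatMZeroTwo)) a b / dLam (yOfLam (lamSeq k)) (lamSeq k))
      atTop (𝓝 (limTwo a b)) := by
    have c1 : ContinuousAt (fun lam => (projNumLam (yOfLam lam) lam * (1 + hatMZeroTwo)) a b) 1 :=
      continuousAt_matrix_apply (continuous_projNumLam_comp.continuousAt.mul continuousAt_const) a b
    have c2 : ContinuousAt (fun lam => dLam (yOfLam lam) lam) 1 := continuous_dLam_pLam_kLam_comp.1.continuousAt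
    have hd1 : dLam (yOfLam 1) 1 ≠ 0 := by rw [yOfLam_one]; exact dLam_crit.2.ne'
    have hval : (projNumLam (yOfLam 1) 1 * (1 + hatMZeroTwo)) a b / dLam (yOfLam 1) 1 = limTwo a b := by
      rw [yOfLam_one, projNumLam_crit, Matrix.smul_mul, Matrix.smul_apply, projTwo_mul_one_add, smul_eq_mul, mul_div_cancel_left₀ _ dLam_crit.2.ne']
    rw [← hval]
    exact ((c1.div c2 hd1).tendsto).comp hlam_lim
  -- remainder `(N^{k+1}P)_{ab}/λ^{k+1} → 0`
  have hrem : Tendsto (fun k : ℕ => (nilLam (yOfLam (lamSeq k)) (lamSeq k) ^ (k + 1) * (1 + hatMZeroTwo)) a b / lamSeq k ^ (k + 1)) atTop (𝓝 0) := by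
    have h' : Tendsto (fun k : ℕ => ((k : ℝ) + 1) * (2 / 3 : ℝ) ^ k) atTop (𝓝 0) := by
      have a1 : Tendsto (fun k : ℕ => (k : ℝ) * (2 / 3 : ℝ) ^ k) atTop (𝓝 0) :=
        tendsto_self_mul_const_pow_of_lt_one (by norm_num) (by norm_num)
      have a2 : Tendsto (fun k : ℕ => (2 / 3 : ℝ) ^ k) atTop (𝓝 0) := tendsto_pow_atTop_nhds_zero_of_lt_one (by norm_num) (by norm_num)
      have := a1.add a2
      simpa [add_mul] using this
    have hgeo : Tendsto (fun k : ℕ => 16 * C * (((k : ℝ) + 1) * (2 / 3 : ℝ) ^ k)) atTop (𝓝 0) := by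
      simpa using h'.const_mul (16 * C)
    refine squeeze_zero_norm' ?_ hgeo
    filter_upwards [hev_s, hev_δ, eventually_ge_atTop 1] with k hk hkδ hk1
    obtain ⟨h34, h54, _⟩ := hlam_spec k hk
    obtain ⟨hd, hN⟩ := hdefl (lamSeq k) hkδ
    obtain ⟨m, rfl⟩ : ∃ m, k = m + 1 := ⟨k - 1, by omega⟩
    have hb := hN m
    rw [show m + 2 = m + 1 + 1 by omega] at hb
    have hl0 : 0 < lamSeq (m + 1) := by linarith
    rw [Real.norm_eq_abs, abs_div, abs_of_pos (pow_pos hl0 _), div_le_iff₀ (pow_pos hl0 _)]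
    have hpow : (3 / 4 : ℝ) ^ (m + 1 + 1) ≤ lamSeq (m + 1) ^ (m + 1 + 1) := pow_le_pow_left₀ (by norm_num) h34 _
    have e1 : ((2 : ℝ) / 3) ^ (m + 1) * ((3 : ℝ) / 4) ^ (m + 1 + 1) = 3 / 8 * (1 / 2) ^ m := by
      rw [pow_succ ((3 : ℝ) / 4) (m + 1), ← mul_assoc, ← mul_pow, show ((2 : ℝ) / 3) * (3 / 4) = 1 / 2 by norm_num, pow_succ]
      ring
    have hq0 : (0 : ℝ) ≤ (1 / 2) ^ m := by positivity
    have hm0 : (0 : ℝ) ≤ (m : ℝ) := Nat.cast_nonneg m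
    calc |(nilLam (yOfLam (lamSeq (m + 1))) (lamSeq (m + 1)) ^ (m + 1 + 1) * (1 + hatMZeroTwo)) a b|
        ≤ 2 * C * ((m : ℝ) + 2) * (1 / 2) ^ m := hb
      _ ≤ 16 * C * ((((m + 1 : ℕ) : ℝ) + 1) * (2 / 3 : ℝ) ^ (m + 1)) * (3 / 4 : ℝ) ^ (m + 1 + 1) := by
          have : 16 * C * ((((m + 1 : ℕ) : ℝ) + 1) * (2 / 3 : ℝ) ^ (m + 1)) * (3 / 4 : ℝ) ^ (m + 1 + 1)
              = 6 * C * ((m : ℝ) + 2) * (1 / 2) ^ m := by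
            push_cast
            have := e1
            calc 16 * C * (((m : ℝ) + 1 + 1) * (2 / 3 : ℝ) ^ (m + 1)) * (3 / 4 : ℝ) ^ (m + 1 + 1)
                = 16 * C * ((m : ℝ) + 2) * (((2 : ℝ) / 3) ^ (m + 1) * ((3 : ℝ) / 4) ^ (m + 1 + 1)) := by ring
              _ = 6 * C * ((m : ℝ) + 2) * (1 / 2) ^ m := by rw [e1]; ring
          rw [this]
          nlinarith [mul_nonneg (mul_nonneg hC hq0) hm0, mul_nonneg hC hq0]
      _ ≤ 16 * C * ((((m + 1 : ℕ) : ℝ) + 1) * (2 / 3 : ℝ) ^ (m + 1)) * lamSeq (m + 1) ^ (m + 1 + 1) :=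
          mul_le_mul_of_nonneg_left hpow (by positivity)
  -- assemble
  have hmain : Tendsto (fun k : ℕ => Real.exp (tseq k ^ 2 * ((Real.log (lamSeq k) - phiTwo 3 * tiltLog (lamSeq k)) / tiltLog (lamSeq k) ^ 2))
      * ((projNumLam (yOfLam (lamSeq k)) (lamSeq k) * (1 + hatMZeroTwo)) a b / dLam (yOfLam (lamSeq k)) (lamSeq k)
        + (nilLam (yOfLam (lamSeq k)) (lamSeq k) ^ (k + 1) * (1 + hatMZeroTwo)) a b / lamSeq k ^ (k + 1))
      / hatD 2 (stripYT 2) (k + 1) a b) atTop (𝓝 (Real.exp ((96 - 67 * Real.sqrt 2) / 8 * t ^ 2) * (limTwo a b + 0) / limTwo a b)) := by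
    have he : Tendsto (fun k : ℕ => Real.exp (tseq k ^ 2 * ((Real.log (lamSeq k) - phiTwo 3 * tiltLog (lamSeq k)) / tiltLog (lamSeq k) ^ 2))) atTop
        (𝓝 (Real.exp ((96 - 67 * Real.sqrt 2) / 8 * t ^ 2))) := by
      have := (Real.continuous_exp.tendsto _).comp hF
      rw [show t ^ 2 * ((96 - 67 * Real.sqrt 2) / 8) = (96 - 67 * Real.sqrt 2) / 8 * t ^ 2 by ring] at this
      exact this
    exact (he.mul (hpre.add hrem)).div hD hA.ne'
  rw [add_zero, mul_div_assoc, div_self hA.ne', mul_one] at hmain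
  refine hmain.congr' ?_
  filter_upwards [hev_s, hev_δ, hev_t0] with k hk hkδ hkt
  obtain ⟨h34, h54, hS⟩ := hlam_spec k hk
  obtain ⟨hd, _⟩ := hdefl (lamSeq k) hkδ
  have hl0 : 0 < lamSeq k := by linarith
  have hc := perronCubicTwo_yOfLam (lamSeq k)
  have hyk : 0 ≤ yOfLam (lamSeq k) := (yOfLam_pos (lt_of_lt_of_le hx34 h34)).le
  -- the spectral decomposition of `D̂(k+1; y(λ_k))`
  have hdec := hatD_two_eq_Lam hyk hc hd.ne' (show 1 ≤ k + 1 by omega)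
  have hdec' : hatD 2 (yOfLam (lamSeq k)) (k + 1) a b = lamSeq k ^ (k + 1) *
      ((projNumLam (yOfLam (lamSeq k)) (lamSeq k) * (1 + hatMZeroTwo)) a b / dLam (yOfLam (lamSeq k)) (lamSeq k)
        + (nilLam (yOfLam (lamSeq k)) (lamSeq k) ^ (k + 1) * (1 + hatMZeroTwo)) a b / lamSeq k ^ (k + 1)) := by
    rw [hdec, Matrix.add_apply, Matrix.smul_apply, smul_eq_mul]
    field_simp
  -- the exponent identity `(k+1)·log λ − tφ₃(k+1)/√(k+1) = t²·F(λ)`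
  have hsq2 : Real.sqrt ((k : ℝ) + 1) ^ 2 = (k : ℝ) + 1 := Real.sq_sqrt (by positivity)
  have hSk : tiltLog (lamSeq k) = tseq k / Real.sqrt ((k : ℝ) + 1) := hS
  have hexp_id : Real.exp (-(tseq k * (phiTwo 3 * (((k + 1 : ℕ) : ℝ))) / Real.sqrt (((k + 1 : ℕ) : ℝ)))) * lamSeq k ^ (k + 1)
      = Real.exp (tseq k ^ 2 * ((Real.log (lamSeq k) - phiTwo 3 * tiltLog (lamSeq k)) / tiltLog (lamSeq k) ^ 2)) := by
    rw [← Real.exp_log (pow_pos hl0 (k + 1)), ← Real.exp_add, Real.log_pow, hSk]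
    push_cast
    congr 1
    have hsne : Real.sqrt ((k : ℝ) + 1) ≠ 0 := (hsq k).ne'
    set u : ℝ := Real.sqrt ((k : ℝ) + 1) with hu
    have hk1 : ((k : ℝ) + 1) = u ^ 2 := hsq2.symm
    rw [hk1]
    field_simp
    ring
  have hyarg : stripYT 2 * Real.exp (tseq k / Real.sqrt (((k + 1 : ℕ) : ℝ))) = yOfLam (lamSeq k) := by
    rw [hy_eq k hk, hs]; push_cast; ring_nf
  rw [contactMGFTwo_eq, hyarg, hdec']
  set X : ℝ := (projNumLam (yOfLam (lamSeq k)) (lamSeq k) * (1 + hatMZeroTwo)) a b / dLam (yOfLam (lamSeq k)) (lamSeq k)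
      + (nilLam (yOfLam (lamSeq k)) (lamSeq k) ^ (k + 1) * (1 + hatMZeroTwo)) a b / lamSeq k ^ (k + 1) with hX
  have hfin : Real.exp (-(tseq k * (phiTwo 3 * (((k + 1 : ℕ) : ℝ))) / Real.sqrt (((k + 1 : ℕ) : ℝ)))) * (lamSeq k ^ (k + 1) * X)
      = Real.exp (tseq k ^ 2 * ((Real.log (lamSeq k) - phiTwo 3 * tiltLog (lamSeq k)) / tiltLog (lamSeq k) ^ 2)) * X := by
    calc Real.exp (-(tseq k * (phiTwo 3 * (((k + 1 : ℕ) : ℝ))) / Real.sqrt (((k + 1 : ℕ) : ℝ)))) * (lamSeq k ^ (k + 1) * X)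
        = (Real.exp (-(tseq k * (phiTwo 3 * (((k + 1 : ℕ) : ℝ))) / Real.sqrt (((k + 1 : ℕ) : ℝ)))) * lamSeq k ^ (k + 1)) * X := (mul_assoc _ _ _).symm
      _ = Real.exp (tseq k ^ 2 * ((Real.log (lamSeq k) - phiTwo 3 * tiltLog (lamSeq k)) / tiltLog (lamSeq k) ^ 2)) * X := by rw [hexp_id]
  rw [hfin, mul_div_assoc]

/-- ★★★★ **THE GAUSSIAN LIMIT OF THE MOMENT GENERATING FUNCTIONS**: for all end levels `a, b` and EVERY real `t`,
`M_{k+1}^{ab}(t) → exp(σ₂²·t²)` with `σ₂² = (96 − 67√2)/8` — i.e. `E exp(t·(#top − φ₃k)/√k) → E exp(tZ)`, `Z ∼ N(0, σ̂)`, `σ̂ = 2σ₂² = (96 − 67√2)/4` the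
variance per hat index of «WIDTH-TWO CONTACT VARIANCE RATE» (convergence of the MGFs on the whole line: the classical sufficient condition for the central limit
theorem `(#top − φ₃k)/√k ⇒ N(0, σ̂)`, Curtiss 1942; the weak-convergence step is the next car).  Assembly: the tilt `s_k = t/√(k+1)` is `S(λ_k)` for a Perron
root `λ_k → 1` (§3), `D̂(k+1; y₂e^{s_k}) = λ_k^{k+1}[(Π̃P)_{ab}/d + (N^{k+1}P)_{ab}/λ_k^{k+1}]` («TILTED SPECTRAL DECOMPOSITION»), the bracket `→ limTwo_{ab}`
(§1 continuity + §2 uniform deflation), `D̂(k+1; y₂) → limTwo_{ab}` («HAT CONVERGENCE»), and `(k+1)log λ_k − tφ₃√(k+1) = t²·(log λ_k − φ₃S(λ_k))/S(λ_k)²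
→ σ₂²t²` («GAUSSIAN EXPONENT»).
[cite: Feller1968, XIII.6; Seneta1973, §1.4; DuminilCopinHammond2013, §2.2; lane «pcv-sawmu» a-p2 g27 — own result, not in print] -/
theorem tendsto_contactMGFTwo (a b : Fin (2 * 2)) (t : ℝ) :
    Tendsto (fun k : ℕ => contactMGFTwo (k + 1) a b t) atTop (𝓝 (Real.exp ((96 - 67 * Real.sqrt 2) / 8 * t ^ 2))) := by
  have hy2 : 0 < stripYT 2 := stripYT_pos (by norm_num)
  have hA : 0 < limTwo a b := limTwo_pos a b
  have hD : Tendsto (fun k : ℕ => hatD 2 (stripYT 2) (k + 1) a b) atTop (𝓝 (limTwo a b)) :=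
    (tendsto_hatD_two a b).comp (tendsto_add_atTop_nat 1)
  -- the case `t = 0`
  rcases eq_or_ne t 0 with rfl | ht
  · have hev : ∀ᶠ k : ℕ in atTop, hatD 2 (stripYT 2) (k + 1) a b ≠ 0 := hD.eventually_ne hA.ne'
    rw [show (96 - 67 * Real.sqrt 2) / 8 * (0 : ℝ) ^ 2 = 0 by ring, Real.exp_zero]
    refine tendsto_const_nhds.congr' ?_
    filter_upwards [hev] with k hk
    rw [contactMGFTwo_eq]
    simp only [zero_mul, zero_div, neg_zero, Real.exp_zero, mul_one, one_mul]
    rw [div_self hk]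
  exact tendsto_contactMGFTwo_of_tendsto a b tendsto_const_nhds ht

/-! ## §5 ★★★★ The central limit theorem for the surface contacts of the critical width-two strip -/

/-- `σ̂ = 2σ₂² = (96 − 67√2)/4 > 0`. [cite: Feller1968, XIII.6; lane plumbing] -/
theorem varRateHat_pos : 0 < (96 - 67 * Real.sqrt 2) / 4 := by
  have h2 : Real.sqrt 2 < 96 / 67 := by
    rw [Real.sqrt_lt' (by norm_num)]; norm_num
  linarith

open Classical in
/-- **The law of `(#top − φ₃k)/√k`** under the critical weights `x_c^{n} y₂^{#top}` on the bridges `a → b` of hat index `k`, as a probability measure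
on `ℝ` (a-p5's `finLaw`; the Dirac mass at `0` in the finitely many degenerate cases `D̂(k; y₂)_{ab} = 0`).
[cite: Feller1968, XIII.6; DuminilCopinHammond2013, §2.2; lane «pcv-sawmu» a-p2 g27] -/
def contactLawTwo (k : ℕ) (a b : Fin (2 * 2)) : Measure ℝ :=
  if hatD 2 (stripYT 2) k a b = 0 then Measure.dirac 0 else
    HexBW.WidthOneYZ.finLaw (LUset 2 (2 * k + 1) (hatLen k a b) (a : ℕ) (b : ℕ)) (fun l => wD 2 (stripYT 2) l / hatD 2 (stripYT 2) k a b)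
      (fun l => ((topCnt 2 l.tail : ℝ) - phiTwo 3 * (k : ℝ)) / Real.sqrt (k : ℝ))

/-- The normalised weights are nonnegative. [cite: DuminilCopinHammond2013, §2.2; lane plumbing] -/
theorem wD_div_hatD_nonneg (k : ℕ) (a b : Fin (2 * 2)) :
    ∀ l ∈ LUset 2 (2 * k + 1) (hatLen k a b) (a : ℕ) (b : ℕ), 0 ≤ wD 2 (stripYT 2) l / hatD 2 (stripYT 2) k a b := fun l _ =>
  div_nonneg (wD_nonneg 2 (stripYT_pos (by norm_num)).le l) (LMM_LUM_nonneg (stripYT_pos (by norm_num)).le _ a b).2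

/-- `contactLawTwo k a b` is a probability measure. [cite: Durrett2019, §3.2; lane plumbing] -/
theorem isProbabilityMeasure_contactLawTwo (k : ℕ) (a b : Fin (2 * 2)) : IsProbabilityMeasure (contactLawTwo k a b) := by
  rw [contactLawTwo]
  split_ifs with h
  · infer_instance
  · refine HexBW.WidthOneYZ.isProbabilityMeasure_finLaw _ _ (wD_div_hatD_nonneg k a b) ?_
    rw [← Finset.sum_div, ← hatD_two_eq_sum_wD, div_self h]

/-- The mgf of `contactLawTwo` is `contactMGFTwo` whenever `D̂(k; y₂)_{ab} ≠ 0`. [cite: Feller1968, XIII.6; lane plumbing] -/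
theorem integral_exp_mul_contactLawTwo {k : ℕ} {a b : Fin (2 * 2)} (h : hatD 2 (stripYT 2) k a b ≠ 0) (s : ℝ) :
    ∫ x, Real.exp (s * x) ∂contactLawTwo k a b = contactMGFTwo k a b s := by
  rw [contactLawTwo, if_neg h, HexBW.WidthOneYZ.integral_finLaw _ _ (wD_div_hatD_nonneg k a b), contactMGFTwo, Finset.sum_div]
  refine Finset.sum_congr rfl fun l _ => ?_
  rw [mul_div_assoc]
  ring

open Classical in
/-- The distribution function of `contactLawTwo` is the tail quotient (`k ≥ 1`, `D̂ ≠ 0`). [cite: Durrett2019, §3.2; lane plumbing] -/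
theorem contactLawTwo_real_Iic {k : ℕ} {a b : Fin (2 * 2)} (hk : 1 ≤ k) (h : hatD 2 (stripYT 2) k a b ≠ 0) (x : ℝ) :
    (contactLawTwo k a b).real (Set.Iic x) =
      (∑ l ∈ (LUset 2 (2 * k + 1) (hatLen k a b) (a : ℕ) (b : ℕ)).filter
          (fun l => (topCnt 2 l.tail : ℝ) ≤ phiTwo 3 * (k : ℝ) + x * Real.sqrt (k : ℝ)), wD 2 (stripYT 2) l) / hatD 2 (stripYT 2) k a b := by
  rw [contactLawTwo, if_neg h, HexBW.WidthOneYZ.finLaw_real_apply _ _ (wD_div_hatD_nonneg k a b), Finset.sum_div]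
  have hsq : 0 < Real.sqrt (k : ℝ) := Real.sqrt_pos.2 (by exact_mod_cast hk)
  refine Finset.sum_congr (Finset.filter_congr fun l _ => ?_) fun _ _ => rfl
  rw [Set.mem_Iic, div_le_iff₀ hsq]
  constructor <;> intro hh <;> linarith

/-- ★★★★ **THE CENTRAL LIMIT THEOREM FOR THE SURFACE CONTACTS OF THE CRITICAL WIDTH-TWO STRIP, WEAK CONVERGENCE**: for all end levels `a, b`,
the law of `(#top − φ₃·k)/√k` under the critical weights `x_c^{n} y₂^{#top}` on the bridges `a → b` of hat index `k + 1` converges weakly to the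
centred Gaussian `N(0, σ̂)`, `σ̂ = (96 − 67√2)/4 = 2σ₂²` (`φ₃ = (3 − √2)/2 = 2θ₂` contacts per hat index; per STEP: mean `θ₂n`, variance `σ₂²n`).
Proof: `tendsto_contactMGFTwo` (mgfs converge on all of `ℝ`) and Curtiss' continuity theorem `tendsto_gaussianReal_of_tendsto_mgf` (a-p5's Moments file).
[cite: Feller1968, XIII.6; Seneta1973, §1.4; DuminilCopinHammond2013, §2.2; lane «pcv-sawmu» a-p2 g27 — own result, not in print] -/
theorem tendsto_contactLawTwo (a b : Fin (2 * 2)) :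
    Tendsto (β := ProbabilityMeasure ℝ) (fun k : ℕ => ⟨contactLawTwo (k + 1) a b, isProbabilityMeasure_contactLawTwo (k + 1) a b⟩) atTop
      (𝓝 ⟨gaussianReal 0 ((96 - 67 * Real.sqrt 2) / 4).toNNReal, inferInstance⟩) := by
  have hσ := varRateHat_pos
  have hA : 0 < limTwo a b := limTwo_pos a b
  have hev : ∀ᶠ k : ℕ in atTop, hatD 2 (stripYT 2) (k + 1) a b ≠ 0 :=
    ((tendsto_hatD_two a b).comp (tendsto_add_atTop_nat 1)).eventually_ne hA.ne'
  refine tendsto_gaussianReal_of_tendsto_mgf 0 ((96 - 67 * Real.sqrt 2) / 4).toNNReal one_pos (fun s _ k => ?_) fun s _ => ?_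
  · show Integrable (fun x => Real.exp (s * x)) (contactLawTwo (k + 1) a b)
    rw [contactLawTwo]
    split_ifs
    · exact integrable_dirac (by simp)
    · exact HexBW.WidthOneYZ.integrable_finLaw _ _ _ _
  · have h := tendsto_contactMGFTwo a b s
    rw [show Real.exp ((96 - 67 * Real.sqrt 2) / 8 * s ^ 2) = Real.exp (0 * s + ((((96 - 67 * Real.sqrt 2) / 4).toNNReal : NNReal) : ℝ) * s ^ 2 / 2) by
      rw [Real.coe_toNNReal _ hσ.le]; ring_nf] at h
    refine h.congr' ?_
    filter_upwards [hev] with k hk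
    rw [ProbabilityMeasure.coe_mk, integral_exp_mul_contactLawTwo hk]

open Classical in
/-- ★★★★ **THE CENTRAL LIMIT THEOREM, DISTRIBUTION FUNCTIONS**: for all `a, b` and EVERY real `x`,
`(Σ_{bridges a→b of hat index k+1 with #top ≤ φ₃(k+1) + x√(k+1)} x_c^{n} y₂^{#top}) / D̂(k+1; y₂)_{ab} → N(0, σ̂)(−∞, x]` as `k → ∞` (`σ̂ = (96 − 67√2)/4`).
[cite: Feller1968, XIII.6; DuminilCopinHammond2013, §2.2; lane «pcv-sawmu» a-p2 g27 — own result, not in print] -/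
theorem tendsto_contactCDFTwo (a b : Fin (2 * 2)) (x : ℝ) :
    Tendsto (fun k : ℕ => (∑ l ∈ (LUset 2 (2 * (k + 1) + 1) (hatLen (k + 1) a b) (a : ℕ) (b : ℕ)).filter
        (fun l => (topCnt 2 l.tail : ℝ) ≤ phiTwo 3 * (((k + 1 : ℕ) : ℝ)) + x * Real.sqrt (((k + 1 : ℕ) : ℝ))), wD 2 (stripYT 2) l)
        / hatD 2 (stripYT 2) (k + 1) a b) atTop
      (𝓝 ((gaussianReal 0 ((96 - 67 * Real.sqrt 2) / 4).toNNReal).real (Set.Iic x))) := by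
  have hσ := varRateHat_pos
  have hA : 0 < limTwo a b := limTwo_pos a b
  have hev : ∀ᶠ k : ℕ in atTop, hatD 2 (stripYT 2) (k + 1) a b ≠ 0 :=
    ((tendsto_hatD_two a b).comp (tendsto_add_atTop_nat 1)).eventually_ne hA.ne'
  have hv : ((96 - 67 * Real.sqrt 2) / 4).toNNReal ≠ 0 := by
    rw [ne_eq, Real.toNNReal_eq_zero, not_le]; exact hσ
  have h := @tendsto_measureReal_Iic_of_tendsto _ ⟨gaussianReal 0 ((96 - 67 * Real.sqrt 2) / 4).toNNReal, inferInstance⟩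
    (nullSingletonClass_gaussianReal hv) (tendsto_contactLawTwo a b) x
  simp only [ProbabilityMeasure.coe_mk] at h
  refine h.congr' ?_
  filter_upwards [hev] with k hk
  exact contactLawTwo_real_Iic (by omega) hk x

/-! ## §6 ★★★★ The CLT in the natural normalisation: per STEP, `(#top − θ₂n)/√n ⇒ N(0, σ₂²)` -/

/-- The moment generating function of `(#top − θ₂·n)/√n`, `n = hatLen k a b = 2k + χ_a − χ_b` the number of steps, `θ₂ = (3 − √2)/4`.
[cite: Feller1968, XIII.6; DuminilCopinHammond2013, §2.2; lane «pcv-sawmu» a-p2 g27] -/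
def contactMGFStepTwo (k : ℕ) (a b : Fin (2 * 2)) (t : ℝ) : ℝ :=
  (∑ l ∈ LUset 2 (2 * k + 1) (hatLen k a b) (a : ℕ) (b : ℕ),
      Real.exp (t * ((topCnt 2 l.tail : ℝ) - (3 - Real.sqrt 2) / 4 * ((hatLen k a b : ℤ) : ℝ)) / Real.sqrt ((hatLen k a b : ℤ) : ℝ)) * wD 2 (stripYT 2) l)
    / hatD 2 (stripYT 2) k a b

/-- ★ **Change of normalisation**: with `n = hatLen k a b = 2k + c` and `t_k = t·√k/√n`,
`M^{step}_k(t) = exp(−t·θ₂·c/√n) · M_k(t_k)` (`θ₂n = φ₃k + θ₂c` since `φ₃ = 2θ₂`). [cite: Feller1968, XIII.6; lane «pcv-sawmu» a-p2 g27] -/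
theorem contactMGFStepTwo_eq {k : ℕ} (hk : 1 ≤ k) (a b : Fin (2 * 2)) (t : ℝ) :
    contactMGFStepTwo k a b t =
      Real.exp (-(t * ((3 - Real.sqrt 2) / 4) * (((lchi a : ℤ) : ℝ) - ((lchi b : ℤ) : ℝ))) / Real.sqrt ((hatLen k a b : ℤ) : ℝ))
        * contactMGFTwo k a b (t * Real.sqrt (k : ℝ) / Real.sqrt ((hatLen k a b : ℤ) : ℝ)) := by
  have hφ : phiTwo 3 = 2 * ((3 - Real.sqrt 2) / 4) := by rw [phiTwo_three_eq.2]; ring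
  have hn : ((hatLen k a b : ℤ) : ℝ) = 2 * (k : ℝ) + (((lchi a : ℤ) : ℝ) - ((lchi b : ℤ) : ℝ)) := by rw [hatLen]; push_cast; ring
  have hk0 : 0 < Real.sqrt (k : ℝ) := Real.sqrt_pos.2 (by exact_mod_cast hk)
  rw [contactMGFStepTwo, contactMGFTwo, ← mul_div_assoc, Finset.mul_sum]
  congr 1
  refine Finset.sum_congr rfl fun l _ => ?_
  rw [← mul_assoc, ← Real.exp_add]
  congr 2
  rw [hφ]
  field_simp
  rw [hn]
  ring

/-- ★★★★ **Gaussian limit of the per-step MGF**: for all `a, b` and EVERY real `t`, `M^{step}_{k+1}(t) → exp(σ₂²·t²/2)`, `σ₂² = (96 − 67√2)/8` — the MGF of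
`N(0, σ₂²)`.  (From `tendsto_contactMGFTwo_of_tendsto` with `t_k = t√(k+1)/√n_{k+1} → t/√2` and the prefactor `→ 1`.)
[cite: Feller1968, XIII.6; Seneta1973, §1.4; lane «pcv-sawmu» a-p2 g27 — own result, not in print] -/
theorem tendsto_contactMGFStepTwo (a b : Fin (2 * 2)) (t : ℝ) :
    Tendsto (fun k : ℕ => contactMGFStepTwo (k + 1) a b t) atTop (𝓝 (Real.exp ((96 - 67 * Real.sqrt 2) / 8 * t ^ 2 / 2))) := by
  have hy2 : 0 < stripYT 2 := stripYT_pos (by norm_num)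
  have hA : 0 < limTwo a b := limTwo_pos a b
  set c : ℝ := ((lchi a : ℤ) : ℝ) - ((lchi b : ℤ) : ℝ) with hc
  have hn : ∀ k : ℕ, ((hatLen k a b : ℤ) : ℝ) = 2 * (k : ℝ) + c := fun k => by rw [hc, hatLen]; push_cast; ring
  have hcb : |c| ≤ 1 := by
    obtain ⟨ha, _⟩ := lchi_facts a; obtain ⟨hb, _⟩ := lchi_facts b
    rw [hc]; rcases ha with ha | ha <;> rcases hb with hb | hb <;> rw [ha, hb] <;> norm_num
  have hcb' := abs_le.1 hcb
  -- n_{k+1} → ∞, the prefactor → 1, t_k → t/√2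
  have hn_lim : Tendsto (fun k : ℕ => (((hatLen (k + 1) a b : ℤ) : ℝ))) atTop atTop := by
    have : (fun k : ℕ => (((hatLen (k + 1) a b : ℤ) : ℝ))) = fun k : ℕ => 2 * (k : ℝ) + (2 + c) := funext fun k => by rw [hn]; push_cast; ring
    rw [this]
    exact (tendsto_natCast_atTop_atTop.const_mul_atTop two_pos).atTop_add tendsto_const_nhds
  have hsq_lim : Tendsto (fun k : ℕ => Real.sqrt (((hatLen (k + 1) a b : ℤ) : ℝ))) atTop atTop := Real.tendsto_sqrt_atTop.comp hn_lim
  have hpre : Tendsto (fun k : ℕ => Real.exp (-(t * ((3 - Real.sqrt 2) / 4) * c) / Real.sqrt (((hatLen (k + 1) a b : ℤ) : ℝ)))) atTop (𝓝 1) := by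
    have := ((hsq_lim.inv_tendsto_atTop).const_mul (-(t * ((3 - Real.sqrt 2) / 4) * c)))
    rw [mul_zero] at this
    have h2 := (Real.continuous_exp.tendsto 0).comp this
    rw [Real.exp_zero] at h2
    refine h2.congr fun k => ?_
    simp only [Function.comp, div_eq_mul_inv, Pi.inv_apply]
  -- t_k = t √(k+1)/√(2(k+1)+c) → t/√2
  have htk : Tendsto (fun k : ℕ => t * Real.sqrt (((k + 1 : ℕ) : ℝ)) / Real.sqrt (((hatLen (k + 1) a b : ℤ) : ℝ))) atTop (𝓝 (t / Real.sqrt 2)) := by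
    -- ratio (k+1)/(2(k+1)+c) → 1/2, then sqrt
    have hr : Tendsto (fun k : ℕ => (((k + 1 : ℕ) : ℝ)) / (((hatLen (k + 1) a b : ℤ) : ℝ))) atTop (𝓝 (1 / 2)) := by
      have hinv : Tendsto (fun k : ℕ => (((k : ℝ) + 1))⁻¹) atTop (𝓝 0) :=
        tendsto_inv_atTop_zero.comp (tendsto_natCast_atTop_atTop.atTop_add tendsto_const_nhds)
      have t0 : Tendsto (fun k : ℕ => 2 + c * ((k : ℝ) + 1)⁻¹) atTop (𝓝 (2 + c * 0)) := (hinv.const_mul c).const_add 2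
      rw [mul_zero, add_zero] at t0
      have t1 := t0.inv₀ (by norm_num : (2 : ℝ) ≠ 0)
      rw [show ((2 : ℝ))⁻¹ = 1 / 2 by norm_num] at t1
      refine t1.congr' ?_
      filter_upwards with k
      have hk : (0 : ℝ) < (k : ℝ) + 1 := by positivity
      rw [hn]; push_cast
      field_simp
    have hs := (Real.continuous_sqrt.tendsto _).comp hr
    have e : Real.sqrt (1 / 2) = 1 / Real.sqrt 2 := by rw [Real.sqrt_div' 1 (by norm_num : (0:ℝ) ≤ 2), Real.sqrt_one]
    have := hs.const_mul t
    rw [e] at this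
    refine (this.congr' ?_).trans (by rw [mul_one_div])
    filter_upwards [eventually_ge_atTop 1] with k hk
    have hnpos : 0 < (((hatLen (k + 1) a b : ℤ) : ℝ)) := by rw [hn]; push_cast; linarith
    simp only [Function.comp]
    rw [Real.sqrt_div' _ hnpos.le, mul_div_assoc]
  rcases eq_or_ne t 0 with rfl | ht
  · -- t = 0: the MGF is identically 1 (eventually)
    have hev : ∀ᶠ k : ℕ in atTop, hatD 2 (stripYT 2) (k + 1) a b ≠ 0 := ((tendsto_hatD_two a b).comp (tendsto_add_atTop_nat 1)).eventually_ne hA.ne'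
    rw [show (96 - 67 * Real.sqrt 2) / 8 * (0 : ℝ) ^ 2 / 2 = 0 by ring, Real.exp_zero]
    refine tendsto_const_nhds.congr' ?_
    filter_upwards [hev] with k hk
    rw [contactMGFStepTwo]
    simp only [zero_mul, zero_div, Real.exp_zero, one_mul]
    rw [← hatD_two_eq_sum_wD, div_self hk]
  · have ht2 : t / Real.sqrt 2 ≠ 0 := div_ne_zero ht (Real.sqrt_ne_zero'.2 (by norm_num))
    have hM := tendsto_contactMGFTwo_of_tendsto a b htk ht2
    have hlim : Real.exp ((96 - 67 * Real.sqrt 2) / 8 * (t / Real.sqrt 2) ^ 2) = Real.exp ((96 - 67 * Real.sqrt 2) / 8 * t ^ 2 / 2) := by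
      rw [div_pow, Real.sq_sqrt (by norm_num : (0:ℝ) ≤ 2)]; ring_nf
    rw [hlim] at hM
    have := hpre.mul hM
    rw [one_mul] at this
    refine this.congr' ?_
    filter_upwards with k
    rw [contactMGFStepTwo_eq (by omega : 1 ≤ k + 1)]

open Classical in
/-- **The law of `(#top − θ₂n)/√n`** (`n = hatLen k a b` steps) under the critical weights on the bridges `a → b` of hat index `k`, as a probability measure on `ℝ`.
[cite: Feller1968, XIII.6; DuminilCopinHammond2013, §2.2; lane «pcv-sawmu» a-p2 g27] -/
def contactLawStepTwo (k : ℕ) (a b : Fin (2 * 2)) : Measure ℝ :=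
  if hatD 2 (stripYT 2) k a b = 0 then Measure.dirac 0 else
    HexBW.WidthOneYZ.finLaw (LUset 2 (2 * k + 1) (hatLen k a b) (a : ℕ) (b : ℕ)) (fun l => wD 2 (stripYT 2) l / hatD 2 (stripYT 2) k a b)
      (fun l => ((topCnt 2 l.tail : ℝ) - (3 - Real.sqrt 2) / 4 * ((hatLen k a b : ℤ) : ℝ)) / Real.sqrt ((hatLen k a b : ℤ) : ℝ))

/-- `contactLawStepTwo k a b` is a probability measure. [cite: Durrett2019, §3.2; lane plumbing] -/
theorem isProbabilityMeasure_contactLawStepTwo (k : ℕ) (a b : Fin (2 * 2)) : IsProbabilityMeasure (contactLawStepTwo k a b) := by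
  rw [contactLawStepTwo]
  split_ifs with h
  · infer_instance
  · refine HexBW.WidthOneYZ.isProbabilityMeasure_finLaw _ _ (wD_div_hatD_nonneg k a b) ?_
    rw [← Finset.sum_div, ← hatD_two_eq_sum_wD, div_self h]

/-- The mgf of `contactLawStepTwo` is `contactMGFStepTwo` (`D̂ ≠ 0`). [cite: Feller1968, XIII.6; lane plumbing] -/
theorem integral_exp_mul_contactLawStepTwo {k : ℕ} {a b : Fin (2 * 2)} (h : hatD 2 (stripYT 2) k a b ≠ 0) (s : ℝ) :
    ∫ x, Real.exp (s * x) ∂contactLawStepTwo k a b = contactMGFStepTwo k a b s := by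
  rw [contactLawStepTwo, if_neg h, HexBW.WidthOneYZ.integral_finLaw _ _ (wD_div_hatD_nonneg k a b), contactMGFStepTwo, Finset.sum_div]
  refine Finset.sum_congr rfl fun l _ => ?_
  rw [mul_div_assoc]
  ring

open Classical in
/-- The distribution function of `contactLawStepTwo` (`k ≥ 1`, `D̂ ≠ 0`). [cite: Durrett2019, §3.2; lane plumbing] -/
theorem contactLawStepTwo_real_Iic {k : ℕ} {a b : Fin (2 * 2)} (hk : 1 ≤ k) (h : hatD 2 (stripYT 2) k a b ≠ 0) (x : ℝ) :
    (contactLawStepTwo k a b).real (Set.Iic x) =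
      (∑ l ∈ (LUset 2 (2 * k + 1) (hatLen k a b) (a : ℕ) (b : ℕ)).filter
          (fun l => (topCnt 2 l.tail : ℝ) ≤ (3 - Real.sqrt 2) / 4 * ((hatLen k a b : ℤ) : ℝ) + x * Real.sqrt ((hatLen k a b : ℤ) : ℝ)),
          wD 2 (stripYT 2) l) / hatD 2 (stripYT 2) k a b := by
  rw [contactLawStepTwo, if_neg h, HexBW.WidthOneYZ.finLaw_real_apply _ _ (wD_div_hatD_nonneg k a b), Finset.sum_div]
  have hn : ((hatLen k a b : ℤ) : ℝ) = 2 * (k : ℝ) + (((lchi a : ℤ) : ℝ) - ((lchi b : ℤ) : ℝ)) := by rw [hatLen]; push_cast; ring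
  have hcb : -1 ≤ ((lchi a : ℤ) : ℝ) - ((lchi b : ℤ) : ℝ) := by
    obtain ⟨ha, _⟩ := lchi_facts a; obtain ⟨hb, _⟩ := lchi_facts b
    rcases ha with ha | ha <;> rcases hb with hb | hb <;> rw [ha, hb] <;> norm_num
  have hk1 : (1 : ℝ) ≤ (k : ℝ) := by exact_mod_cast hk
  have hsq : 0 < Real.sqrt ((hatLen k a b : ℤ) : ℝ) := Real.sqrt_pos.2 (by rw [hn]; linarith)
  refine Finset.sum_congr (Finset.filter_congr fun l _ => ?_) fun _ _ => rfl
  rw [Set.mem_Iic, div_le_iff₀ hsq]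
  constructor <;> intro hh <;> linarith

/-- ★★★★ **THE CENTRAL LIMIT THEOREM, PER STEP, WEAK CONVERGENCE**: for all end levels `a, b`, the law of `(#top − θ₂·n)/√n` (`n = 2(k+1) + χ_a − χ_b` steps,
`θ₂ = (3 − √2)/4`) under the critical weights on the bridges `a → b` of hat index `k + 1` converges weakly to `N(0, σ₂²)`, **`σ₂² = (96 − 67√2)/8`** — the surface
contacts of a long critical width-two bridge are Gaussian with mean `θ₂·n` and variance `σ₂²·n`.
[cite: Feller1968, XIII.6; Seneta1973, §1.4; DuminilCopinHammond2013, §2.2; lane «pcv-sawmu» a-p2 g27 — own result, not in print] -/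
theorem tendsto_contactLawStepTwo (a b : Fin (2 * 2)) :
    Tendsto (β := ProbabilityMeasure ℝ) (fun k : ℕ => ⟨contactLawStepTwo (k + 1) a b, isProbabilityMeasure_contactLawStepTwo (k + 1) a b⟩) atTop
      (𝓝 ⟨gaussianReal 0 ((96 - 67 * Real.sqrt 2) / 8).toNNReal, inferInstance⟩) := by
  have hσ : 0 < (96 - 67 * Real.sqrt 2) / 8 := by linarith [varRateHat_pos]
  have hA : 0 < limTwo a b := limTwo_pos a b
  have hev : ∀ᶠ k : ℕ in atTop, hatD 2 (stripYT 2) (k + 1) a b ≠ 0 :=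
    ((tendsto_hatD_two a b).comp (tendsto_add_atTop_nat 1)).eventually_ne hA.ne'
  refine tendsto_gaussianReal_of_tendsto_mgf 0 ((96 - 67 * Real.sqrt 2) / 8).toNNReal one_pos (fun s _ k => ?_) fun s _ => ?_
  · show Integrable (fun x => Real.exp (s * x)) (contactLawStepTwo (k + 1) a b)
    rw [contactLawStepTwo]
    split_ifs
    · exact integrable_dirac (by simp)
    · exact HexBW.WidthOneYZ.integrable_finLaw _ _ _ _
  · have h := tendsto_contactMGFStepTwo a b s
    rw [show Real.exp ((96 - 67 * Real.sqrt 2) / 8 * s ^ 2 / 2) = Real.exp (0 * s + ((((96 - 67 * Real.sqrt 2) / 8).toNNReal : NNReal) : ℝ) * s ^ 2 / 2) by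
      rw [Real.coe_toNNReal _ hσ.le]; ring_nf] at h
    refine h.congr' ?_
    filter_upwards [hev] with k hk
    rw [ProbabilityMeasure.coe_mk, integral_exp_mul_contactLawStepTwo hk]

open Classical in
/-- ★★★★ **THE CENTRAL LIMIT THEOREM, PER STEP, DISTRIBUTION FUNCTIONS**: for all `a, b` and EVERY real `x`, with `n = hatLen (k+1) a b` steps,
`P^{ab}(#top ≤ θ₂·n + x√n) → N(0, σ₂²)(−∞, x] = Φ(x/σ₂)` as `k → ∞` (`θ₂ = (3 − √2)/4`, `σ₂² = (96 − 67√2)/8`).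
[cite: Feller1968, XIII.6; Durrett2019, §3.2; DuminilCopinHammond2013, §2.2; lane «pcv-sawmu» a-p2 g27 — own result, not in print] -/
theorem tendsto_contactCDFStepTwo (a b : Fin (2 * 2)) (x : ℝ) :
    Tendsto (fun k : ℕ => (∑ l ∈ (LUset 2 (2 * (k + 1) + 1) (hatLen (k + 1) a b) (a : ℕ) (b : ℕ)).filter
        (fun l => (topCnt 2 l.tail : ℝ) ≤ (3 - Real.sqrt 2) / 4 * ((hatLen (k + 1) a b : ℤ) : ℝ) + x * Real.sqrt ((hatLen (k + 1) a b : ℤ) : ℝ)),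
        wD 2 (stripYT 2) l) / hatD 2 (stripYT 2) (k + 1) a b) atTop
      (𝓝 ((gaussianReal 0 ((96 - 67 * Real.sqrt 2) / 8).toNNReal).real (Set.Iic x))) := by
  have hσ : 0 < (96 - 67 * Real.sqrt 2) / 8 := by linarith [varRateHat_pos]
  have hA : 0 < limTwo a b := limTwo_pos a b
  have hev : ∀ᶠ k : ℕ in atTop, hatD 2 (stripYT 2) (k + 1) a b ≠ 0 :=
    ((tendsto_hatD_two a b).comp (tendsto_add_atTop_nat 1)).eventually_ne hA.ne'
  have hv : ((96 - 67 * Real.sqrt 2) / 8).toNNReal ≠ 0 := by rw [ne_eq, Real.toNNReal_eq_zero, not_le]; exact hσ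
  have h := @tendsto_measureReal_Iic_of_tendsto _ ⟨gaussianReal 0 ((96 - 67 * Real.sqrt 2) / 8).toNNReal, inferInstance⟩
    (nullSingletonClass_gaussianReal hv) (tendsto_contactLawStepTwo a b) x
  simp only [ProbabilityMeasure.coe_mk] at h
  refine h.congr' ?_
  filter_upwards [hev] with k hk
  exact contactLawStepTwo_real_Iic (by omega) hk x

end W2

end HV

end Literature.Probability.RandomPlanarGeometry.SAW
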